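import Literature.IUT.HodgeTheaters.InitialThetaDataLocalGalois
import Literature.NumberTheory.EllipticCurves.ShaProofs
import HarnessLib

/-!
# [IUTchI] Def. 3.1 (e): `G_v̲ ≅ Gal(K̄_v̲/K_v̲)` — injectivity of the local-to-global restriction (proofs)

`Proofs` companion (theorems only; no definitions, no instances) of `InitialThetaDataLocalGalois.lean`
(abc-iut-L5-t2). S. Mochizuki, *Inter-universal Teichmüller theory I*, Def. 3.1 (e) (kurims May-2020 manuscript
pp. 62–63) [claim: Mochizuki2012, status: disputed] speaks of "the decomposition group `G_v ⊆ G_K := Gal(F̄/K)`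
determined, up to `G_K`-conjugacy, by `v`" and of "natural outer surjections" of the LOCAL arithmetic fundamental
groups onto it — i.e. it identifies `G_v̲` with the local Galois group `Gal(K̄_v̲/K_v̲)`. Classically (Serre,
*Cohomologie galoisienne*, II.§6.1: "`k̄_w` est une clôture algébrique de `k_v`, et son groupe de Galois est `D_w`")
this is the INJECTIVITY of the restriction `Gal(K̄_v̲/K_v̲) → Gal(F̄/K)` along an embedding `F̄ ↪ K̄_v̲`, a
consequence of Krasner-type density (`K`, hence `F̄`, is dense in `K̄_v̲`). This file proves it for the tree's
`localToGlobal` / `localToGF` of an ABSTRACT algebraic closure `F̄` (as in Def. 3.1 (a)), by the tree's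
`Literature.NumberTheory.EllipticCurves.algEquiv_eq_one_of_forall_apply_algHom` (abc-iut / BSD cell, `ShaProofs.lean`:
an automorphism of `k̄` over a complete `k` fixing a dense subfield pointwise is trivial):
* `localToGlobal_injective`, `localToGF_injective` — for any complete nonarchimedean `K`-field `k` in which `K` is
  dense and any algebraically closed algebraic `Ω ⊇ k`;
* `nonempty_mulEquiv_decompositionSubgroup(GF)` — **`Gal(Ω/k) ≅ G_v̲`**;
* `localToGlobal_injective_adicCompletion`, `localToGF_injective_adicCompletion` — the case `k := K_w`, the
  completion of the number field `K` at a finite place `w` (`K` dense: Mathlib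
  `IsDedekindDomain.HeightOneSpectrum.denseRange_algebraMap`).
Nothing of the disputed series is asserted; no side is taken.
-/

noncomputable section

namespace Literature.IUT.HodgeTheaters

universe u v w w'

/-! ### Injectivity for a complete field with dense `K` -/

section Injective

variable {K : Type v} [Field K] {Fbar : Type w} [Field Fbar] [Algebra K Fbar] [Normal K Fbar] [IsAlgClosed Fbar]
  (k : Type w') [NontriviallyNormedField k] [CompleteSpace k] [IsUltrametricDist k] [Algebra K k]
  {Ω : Type w'} [Field Ω] [Algebra k Ω] [Algebra.IsAlgebraic k Ω] [IsAlgClosed Ω] [Algebra K Ω]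
  [IsScalarTower K k Ω] (ι : Fbar →ₐ[K] Ω)

/-- **`Gal(Ω/k) → Gal(F̄/K)` is injective** when `k` is complete nonarchimedean with `K` dense, `F̄` is
algebraically closed and `Ω ⊇ k` is an algebraically closed algebraic extension: an element of the kernel fixes
the dense subfield `ι(F̄)` of `Ω` pointwise, hence is trivial (uniqueness of the extended absolute value makes it
an isometry). [cite: SerreGaloisCohomology1997, II.§6.1] -/
theorem localToGlobal_injective (hd : DenseRange (algebraMap K k)) : Function.Injective (localToGlobal k ι) := by
  rw [injective_iff_map_eq_one]
  intro σ hσ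
  exact Literature.NumberTheory.EllipticCurves.algEquiv_eq_one_of_forall_apply_algHom hd ι σ fun x => by
    rw [← apply_localToGlobal k ι σ x, hσ, AlgEquiv.one_apply]

/-- **`Gal(Ω/k) ≅ G_v̲ ⊆ Gal(F̄/K)`**: the local Galois group IS the decomposition group (for `k` complete with
`K` dense). [cite: SerreGaloisCohomology1997, II.§6.1] -/
theorem nonempty_mulEquiv_decompositionSubgroup (hd : DenseRange (algebraMap K k)) :
    Nonempty ((Ω ≃ₐ[k] Ω) ≃* decompositionSubgroup k ι) :=
  ⟨MonoidHom.ofInjective (localToGlobal_injective k ι hd)⟩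

variable (F : Type u) [Field F] [Algebra F K] [Algebra F Fbar] [IsScalarTower F K Fbar]

/-- **`Gal(Ω/k) → G_F` is injective** (`k` complete nonarchimedean with `K` dense): `localToGF` is the injective
`localToGlobal` followed by the injective restriction of scalars `Gal(F̄/K) ↪ G_F`.
[cite: SerreGaloisCohomology1997, II.§6.1] -/
theorem localToGF_injective (hd : DenseRange (algebraMap K k)) : Function.Injective (localToGF F k ι) :=
  (AlgEquiv.restrictScalarsHom_injective F).comp (localToGlobal_injective k ι hd)

/-- **`Gal(Ω/k) ≅ G_v̲ ⊆ G_K ⊆ G_F`** (Def. 3.1 (e): the decomposition group of `v̲` inside `G_F`, for `k = K_v̲`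
complete with `K` dense). [claim: Mochizuki2012, status: disputed] -/
theorem nonempty_mulEquiv_decompositionSubgroupGF (hd : DenseRange (algebraMap K k)) :
    Nonempty ((Ω ≃ₐ[k] Ω) ≃* decompositionSubgroupGF F k ι) :=
  ⟨MonoidHom.ofInjective (localToGF_injective k ι F hd)⟩

end Injective

/-! ### At a finite place `w` of the number field `K`: `k := K_w` -/

section Place

open IsDedekindDomain NumberField

variable {K : Type v} [Field K] [NumberField K] {Fbar : Type w} [Field Fbar] [Algebra K Fbar] [Normal K Fbar]
  [IsAlgClosed Fbar] (w : HeightOneSpectrum (𝓞 K))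
  (ι : Fbar →ₐ[K] AlgebraicClosure (w.adicCompletion K))

/-- **`Gal(K̄_w/K_w) → Gal(F̄/K)` is injective** for the completion `K_w` of the number field `K` at a finite
place `w` (`K ⊆ K_w` is dense; `K̄_w :=` Mathlib's algebraic closure of `K_w`): the local Galois group at `w` is
identified with the decomposition group `G_w ⊆ G_K` of Def. 3.1 (e). [cite: SerreGaloisCohomology1997, II.§6.1] -/
theorem localToGlobal_injective_adicCompletion :
    Function.Injective (localToGlobal (w.adicCompletion K) ι) := by
  letI : NontriviallyNormedField (w.adicCompletion K) := Valued.toNontriviallyNormedField _ _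
  exact localToGlobal_injective (w.adicCompletion K) ι (HeightOneSpectrum.denseRange_algebraMap K w)

variable (F : Type u) [Field F] [Algebra F K] [Algebra F Fbar] [IsScalarTower F K Fbar]

/-- **`Gal(K̄_w/K_w) → G_F` is injective** at a finite place `w` of `K`: `G_w ≅ Gal(K̄_w/K_w)` inside `G_K ⊆ G_F`
(Def. 3.1 (e)). [claim: Mochizuki2012, status: disputed] -/
theorem localToGF_injective_adicCompletion : Function.Injective (localToGF F (w.adicCompletion K) ι) := by
  letI : NontriviallyNormedField (w.adicCompletion K) := Valued.toNontriviallyNormedField _ _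
  exact localToGF_injective (w.adicCompletion K) ι F (HeightOneSpectrum.denseRange_algebraMap K w)

/-- **`Gal(K̄_w/K_w) ≅ G_w ⊆ G_F`** at a finite place `w` of `K` (Def. 3.1 (e): "the decomposition group
`G_v ⊆ G_K` … determined, up to `G_K`-conjugacy, by `v`"). [claim: Mochizuki2012, status: disputed] -/
theorem nonempty_mulEquiv_decompositionSubgroupGF_adicCompletion :
    Nonempty ((AlgebraicClosure (w.adicCompletion K) ≃ₐ[w.adicCompletion K] AlgebraicClosure (w.adicCompletion K)) ≃*
      decompositionSubgroupGF F (w.adicCompletion K) ι) :=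
  ⟨MonoidHom.ofInjective (localToGF_injective_adicCompletion w ι F)⟩

end Place

end Literature.IUT.HodgeTheaters

end
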